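import Summits.Ventures.HodgeRepro2.T5HeckeAutomorphismTransport

/-!
# Gelfand's trick for `H(G, K)` — anti-automorphism form

Kernel annex of the Tier-5 record (blind lane); the companion of `T5HeckeGelfandTrick` (inversion
form).  For `GL_n` the inversion does not preserve the double cosets `K diag(ϖ^a) K`, and the
classical proof of the commutativity of the spherical Hecke algebra uses the *transpose*, an
anti-automorphism.  Every anti-automorphism `τ` of `G` is `τ = σ ∘ inv` with `σ` an automorphism,
and on `k[G/K]^K` the map `f ↦ f ∘ τ` is the composite `Φ := transport σ ∘ (t ↦ t^∨)` of the
transport of `T5HeckeAutomorphismTransport` with the anti-involution of `T5HeckeTranspose`: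

* `Φ` is an anti-automorphism of the convolution algebra (`transport_transpose_conv`) and of
  `H(G, K)` (`transportOp_transposeOp_mul`);
* if `x⁻¹ ∈ K σ(x) K` for every `x` (the orbit form `hτ`), `Φ` is the identity
  (`transport_transpose_eq_self`), hence `H(G, K)` is commutative
  (`conv_comm_of_inv_mem_orbit_map`, `mul_comm_of_inv_mem_orbit_map`);
* packaged for an anti-automorphism `τ : G ≃* Gᵐᵒᵖ` with `τ(K) = K` and `τ(x) ∈ K x K` for every
  `x`: `mul_comm_of_antiAut` (`σ := τ` followed by `(MulEquiv.inv' G).symm`, so that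
  `τ x = op (σ x)⁻¹`).

What stays prose: that a *specific* group carries such an anti-automorphism preserving `K` and
every double coset (transpose for `GL_n(F_v)` with `K = GL_n(O_v)` and the Cartan decomposition;
the printed theorems).
-/

namespace Summit.Ventures.HodgeRepro2.T5HeckeGelfandTrickGeneral

open T5HeckePermutationModule T5HeckeConvolution T5HeckeTranspose T5HeckeAutomorphismTransport
  LevelPositivity

variable {G : Type*} [Group G] {k : Type*} [Field k] {K : Subgroup G}

section Convolution

/-- `Φ := transport σ ∘ ∨` reverses the convolution: `Φ(t ∗ s) = Φ(s) ∗ Φ(t)`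
(`t`, `s` `K`-invariant). -/
theorem transport_transpose_conv (hK : ∀ g : G, Finite (MulAction.orbit K (g : G ⧸ K)))
    (σ : G ≃* G) (hσ : ∀ x : G, σ x ∈ K ↔ x ∈ K) {t s : MonoidAlgebra k (G ⧸ K)}
    (ht : t ∈ invariants (Representation.ofMulAction k G (G ⧸ K)) K)
    (hs : s ∈ invariants (Representation.ofMulAction k G (G ⧸ K)) K) :
    transport σ hσ (transpose hK (conv t s)) =
      conv (transport σ hσ (transpose hK s)) (transport σ hσ (transpose hK t)) := by
  rw [transpose_conv hK ht hs, transport_conv σ hσ (transpose_mem_invariants hK hs)]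

/-- `Φ(t)(σ(x)K) = t(x⁻¹K)`: `Φ` is `f ↦ f ∘ τ` for the anti-automorphism `τ = σ⁻¹ ∘ inv`
written on `G ⧸ K`. -/
theorem coeff_transport_transpose_mk (hK : ∀ g : G, Finite (MulAction.orbit K (g : G ⧸ K)))
    (σ : G ≃* G) (hσ : ∀ x : G, σ x ∈ K ↔ x ∈ K) {t : MonoidAlgebra k (G ⧸ K)}
    (ht : t ∈ invariants (Representation.ofMulAction k G (G ⧸ K)) K) (x : G) :
    (transport σ hσ (transpose hK t)).coeff ((σ x : G) : G ⧸ K) = t.coeff ((x⁻¹ : G) : G ⧸ K) := by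
  rw [coeff_transport_mk, coeff_transpose_mk hK ht]

/-- `Φ` preserves the `K`-invariants. -/
theorem transport_transpose_mem_invariants (hK : ∀ g : G, Finite (MulAction.orbit K (g : G ⧸ K)))
    (σ : G ≃* G) (hσ : ∀ x : G, σ x ∈ K ↔ x ∈ K) {t : MonoidAlgebra k (G ⧸ K)}
    (ht : t ∈ invariants (Representation.ofMulAction k G (G ⧸ K)) K) :
    transport σ hσ (transpose hK t) ∈ invariants (Representation.ofMulAction k G (G ⧸ K)) K :=
  transport_mem_invariants σ hσ (transpose_mem_invariants hK ht)

/-- Under the double-coset condition `x⁻¹ ∈ K σ(x) K` for every `x` (orbit form), `Φ` is the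
identity on `k[G/K]^K`: coefficientwise `Φ(t)(σ(x)K) = t(x⁻¹K) = t(σ(x)K)`. -/
theorem transport_transpose_eq_self (hK : ∀ g : G, Finite (MulAction.orbit K (g : G ⧸ K)))
    (σ : G ≃* G) (hσ : ∀ x : G, σ x ∈ K ↔ x ∈ K)
    (hτ : ∀ x : G, ((x⁻¹ : G) : G ⧸ K) ∈ MulAction.orbit K ((σ x : G) : G ⧸ K))
    {t : MonoidAlgebra k (G ⧸ K)}
    (ht : t ∈ invariants (Representation.ofMulAction k G (G ⧸ K)) K) :
    transport σ hσ (transpose hK t) = t := by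
  apply MonoidAlgebra.ext
  apply Finsupp.ext
  intro y
  induction y using QuotientGroup.induction_on with
  | H y =>
    obtain ⟨x, rfl⟩ := σ.surjective y
    rw [coeff_transport_transpose_mk hK σ hσ ht x]
    exact T5HeckeDoubleCosetBasis.coeff_eq_of_mem_orbit ht (hτ x)

/-- Gelfand's trick, convolution form, for the anti-automorphism `σ ∘ inv`:
`t ∗ s = Φ(t ∗ s) = Φ(s) ∗ Φ(t) = s ∗ t`. -/
theorem conv_comm_of_inv_mem_orbit_map (hK : ∀ g : G, Finite (MulAction.orbit K (g : G ⧸ K)))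
    (σ : G ≃* G) (hσ : ∀ x : G, σ x ∈ K ↔ x ∈ K)
    (hτ : ∀ x : G, ((x⁻¹ : G) : G ⧸ K) ∈ MulAction.orbit K ((σ x : G) : G ⧸ K))
    {t s : MonoidAlgebra k (G ⧸ K)}
    (ht : t ∈ invariants (Representation.ofMulAction k G (G ⧸ K)) K)
    (hs : s ∈ invariants (Representation.ofMulAction k G (G ⧸ K)) K) :
    conv t s = conv s t := by
  calc conv t s = transport σ hσ (transpose hK (conv t s)) :=
        (transport_transpose_eq_self hK σ hσ hτ (conv_mem_invariants ht hs)).symm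
    _ = conv (transport σ hσ (transpose hK s)) (transport σ hσ (transpose hK t)) :=
        transport_transpose_conv hK σ hσ ht hs
    _ = conv s t := by
        rw [transport_transpose_eq_self hK σ hσ hτ hs, transport_transpose_eq_self hK σ hσ hτ ht]

end Convolution

section HeckeAlgebra

/-- `Ψ := transportOp σ ∘ transposeOp` is an anti-automorphism of `H(G, K)`:
`Ψ(T S) = Ψ(S) Ψ(T)`. -/
theorem transportOp_transposeOp_mul (hK : ∀ g : G, Finite (MulAction.orbit K (g : G ⧸ K)))
    (σ : G ≃* G) (hσ : ∀ x : G, σ x ∈ K ↔ x ∈ K) (T S : heckeAlgebra k K) :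
    transportOp σ hσ (transposeOp hK (T * S)) =
      transportOp σ hσ (transposeOp hK S) * transportOp σ hσ (transposeOp hK T) := by
  rw [transposeOp_mul, transportOp_mul]

/-- `(Ψ T) δ_K = Φ (T δ_K)`. -/
theorem transportOp_transposeOp_apply_single_one (hK : ∀ g : G, Finite (MulAction.orbit K (g : G ⧸ K)))
    (σ : G ≃* G) (hσ : ∀ x : G, σ x ∈ K ↔ x ∈ K) (T : heckeAlgebra k K) :
    (transportOp σ hσ (transposeOp hK T) : Module.End k (MonoidAlgebra k (G ⧸ K)))
        (MonoidAlgebra.single ((1 : G) : G ⧸ K) 1) =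
      transport σ hσ (transpose hK ((T : Module.End k (MonoidAlgebra k (G ⧸ K)))
        (MonoidAlgebra.single ((1 : G) : G ⧸ K) 1))) := by
  rw [transportOp_apply_single_one, transposeOp_apply_single_one]

/-- Under the double-coset condition `Ψ` is the identity of `H(G, K)`. -/
theorem transportOp_transposeOp_eq_self (hK : ∀ g : G, Finite (MulAction.orbit K (g : G ⧸ K)))
    (σ : G ≃* G) (hσ : ∀ x : G, σ x ∈ K ↔ x ∈ K)
    (hτ : ∀ x : G, ((x⁻¹ : G) : G ⧸ K) ∈ MulAction.orbit K ((σ x : G) : G ⧸ K))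
    (T : heckeAlgebra k K) :
    transportOp σ hσ (transposeOp hK T) = T := by
  apply ext_of_apply_single_one
  rw [transportOp_transposeOp_apply_single_one]
  exact transport_transpose_eq_self hK σ hσ hτ (apply_single_one_mem_invariants T)

/-- **Gelfand's trick** (anti-automorphism form).  If `σ` is an automorphism of `G` with
`σ(K) = K` and `x⁻¹ ∈ K σ(x) K` for every `x ∈ G`, and every `K g K / K` is finite, then
`H(G, K)` is commutative: `T S = Ψ(T S) = Ψ(S) Ψ(T) = S T`. -/
theorem mul_comm_of_inv_mem_orbit_map (hK : ∀ g : G, Finite (MulAction.orbit K (g : G ⧸ K)))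
    (σ : G ≃* G) (hσ : ∀ x : G, σ x ∈ K ↔ x ∈ K)
    (hτ : ∀ x : G, ((x⁻¹ : G) : G ⧸ K) ∈ MulAction.orbit K ((σ x : G) : G ⧸ K))
    (T S : heckeAlgebra k K) : T * S = S * T := by
  calc T * S = transportOp σ hσ (transposeOp hK (T * S)) :=
        (transportOp_transposeOp_eq_self hK σ hσ hτ _).symm
    _ = transportOp σ hσ (transposeOp hK S) * transportOp σ hσ (transposeOp hK T) :=
        transportOp_transposeOp_mul hK σ hσ T S
    _ = S * T := by
        rw [transportOp_transposeOp_eq_self hK σ hσ hτ S,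
          transportOp_transposeOp_eq_self hK σ hσ hτ T]

/-- The inversion form of `T5HeckeGelfandTrick` is the case `σ = 1`. -/
theorem mul_comm_of_inv_mem_orbit' (hK : ∀ g : G, Finite (MulAction.orbit K (g : G ⧸ K))) (hinv : ∀ g : G, ((g⁻¹ : G) : G ⧸ K) ∈ MulAction.orbit K ((g : G) : G ⧸ K))
    (T S : heckeAlgebra k K) : T * S = S * T :=
  mul_comm_of_inv_mem_orbit_map hK (MulEquiv.refl G) (fun _ => Iff.rfl) hinv T S

end HeckeAlgebra

section AntiAutomorphism

/-- The automorphism `σ` attached to an anti-automorphism `τ : G ≃* Gᵐᵒᵖ`: `σ x = (unop (τ x))⁻¹`,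
so that `τ x = op (σ x)⁻¹`. -/
def autOfAntiAut (τ : G ≃* Gᵐᵒᵖ) : G ≃* G := τ.trans (MulEquiv.inv' G).symm

/-- `autOfAntiAut τ x = (unop (τ x))⁻¹`. -/
theorem autOfAntiAut_apply (τ : G ≃* Gᵐᵒᵖ) (x : G) :
    autOfAntiAut τ x = (MulOpposite.unop (τ x))⁻¹ := by
  apply (MulEquiv.inv' G).injective
  rw [autOfAntiAut, MulEquiv.trans_apply, MulEquiv.apply_symm_apply]
  simp

/-- `τ(K) = K` transfers to `σ(K) = K`. -/
theorem autOfAntiAut_mem_iff (τ : G ≃* Gᵐᵒᵖ) (hτK : ∀ x : G, MulOpposite.unop (τ x) ∈ K ↔ x ∈ K)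
    (x : G) : autOfAntiAut τ x ∈ K ↔ x ∈ K := by
  rw [autOfAntiAut_apply, K.inv_mem_iff, hτK]

/-- `τ(x) ∈ K x K` (orbit form `↑(unop (τ x)) ∈ K • (xK)`) transfers to the double-coset condition
`x⁻¹ ∈ K σ(x) K` of `mul_comm_of_inv_mem_orbit_map`. -/
theorem inv_mem_orbit_autOfAntiAut (τ : G ≃* Gᵐᵒᵖ)
    (hτ : ∀ x : G, ((MulOpposite.unop (τ x) : G) : G ⧸ K) ∈ MulAction.orbit K ((x : G) : G ⧸ K))
    (x : G) : ((x⁻¹ : G) : G ⧸ K) ∈ MulAction.orbit K ((autOfAntiAut τ x : G) : G ⧸ K) := by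
  rw [autOfAntiAut_apply, T5HeckeTranspose.mem_orbit_inv_iff, inv_inv,
    MulAction.orbit_eq_iff.2 (hτ x)]
  exact MulAction.mem_orbit_self _

/-- **Gelfand's trick** for an anti-automorphism `τ : G ≃* Gᵐᵒᵖ` of `G` (e.g. the transpose of
`GL_n`): if `τ(K) = K` and `τ(x) ∈ K x K` for every `x`, and every `K g K / K` is finite, then
`H(G, K)` is commutative. -/
theorem mul_comm_of_antiAut (hK : ∀ g : G, Finite (MulAction.orbit K (g : G ⧸ K)))
    (τ : G ≃* Gᵐᵒᵖ) (hτK : ∀ x : G, MulOpposite.unop (τ x) ∈ K ↔ x ∈ K)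
    (hτ : ∀ x : G, ((MulOpposite.unop (τ x) : G) : G ⧸ K) ∈ MulAction.orbit K ((x : G) : G ⧸ K))
    (T S : heckeAlgebra k K) : T * S = S * T :=
  mul_comm_of_inv_mem_orbit_map hK (autOfAntiAut τ) (autOfAntiAut_mem_iff τ hτK)
    (inv_mem_orbit_autOfAntiAut τ hτ) T S

end AntiAutomorphism

end Summit.Ventures.HodgeRepro2.T5HeckeGelfandTrickGeneral
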